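import Summits.QuantumFields.YangMills.Theses.HyperbolicRegulator
import Summits.QuantumFields.YangMills.Theorems.HyperbolicRegulatorCurvatureAnchorRefutation

/-!
# Disproof of `CurvatureAnchor` (stmt-QuantumFields-15826, route `HyperbolicRegulator`) — findings

Standing disprover's work file (`cdisprove`, refuter-cdisprove-stmt-QuantumFields-15826-0, cycle 1, 2026-08-17).
Prose lives in docstrings; everything below elaborates, no `sorry`.

## Findings index

* §0 **THE CRUX AS TYPED IS FALSE — `refuted-misstated`, LANDED** (`Theorems/HyperbolicRegulatorCurvatureAnchorRefutation.lean`,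
  `Summit.QuantumFields.YangMills.Theorems.not_CurvatureAnchor`, commit 896f1b2d, item closed `refuted` 2026-08-17T12:49Z; the
  identical witness was found independently in this seat's `Refutation.lean`, rc 0, axioms propext/Classical.choice/Quot.sound,
  not proposed because the tree file landed first).  Witness: `G = SU(2)` (certified compact simple Lie group,
  `isSimpleCompactGroup_specialUnitaryGroup_holds`), its faithful unitary representation, and the sibling line's
  `NoAdmissibleComplex.no_admissible : 208 ≤ k → ¬ Adm k j …` at `(k, j) = (400, 0)`.  Re-exported here as
  `curvatureAnchor_false`; the `G`-free core as `no_admissible_family`.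
* §1 **LOAD-BEARING ANALYSIS OF THE KILL.**  Only the FIRST conjunct (admissibility at every `k ≥ 8`) is used; the anchor
  (clustering) conjunct, the group, the representation and the measure are never examined.  Inside admissibility the kill
  uses clauses 1–6, 8, 9 and NOT the Poincaré clause 7; its entry point is the coincidence
  *flat threshold `k / 4 < dist x c` = chart sup-radius `(k : ℤ) / 4`* (chart graph-reach `2⌊k/4⌋ ≥ ⌊k/4⌋ + 1`, so the first
  flat shell around a cone is charted and can be tracked to the cone).  `clash_threshold`: the landed constants bite exactly
  for `k ≥ 208` — a restate that merely CAPS `k` (say `8 ≤ k ≤ 200`) escapes the landed theorem but NOT the defect: the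
  intended `{4,5}_k` covers violate clause 9 for every `k ≥ 12` (refuter-rattack `chart_search.py`, exhaustive), and a
  sharper shell count (`≤ 25` germs) bites from `k ≈ 108`.  DO NOT repair by capping `k`.
* §2 **THE REPAIR C′ AND ITS PRE-ATTACK.**  `AdmR` = admissibility with `F := k / 2 < dist` and `Dp := 3 * (k / 4) < dist`,
  chart box unchanged (refuters R3 / ATTACK-15826 / SKELVET, strategist STRATEGY-CENSUS; to be restated in LOCKSTEP in
  `CurvatureUniformity` / `CurvatureAnchor` / `HyperbolicToTorus`, whose `let Fam` must stay byte-identical for `closes`).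
  `repair_arith` (omega, every residue of `k`): chart reach `2⌊k/4⌋ ≤ ⌊k/2⌋` < flat distance, deep ⇒ flat, deep threshold
  `< k` (compatible with `k`-density), support radius `⌊k/8⌋ ≥ 1` with `2⌊k/8⌋ ≤ ⌊k/4⌋`.  `AdmR.chart_avoids_cones`
  (kernel-checked, all `k`): under `AdmR` NO chart contains a cone — the entry point of `no_admissible` is closed for every
  complex, not only for the intended one.  `CurvatureAnchorR` = the crux with exactly these two tokens changed (C′; believed to
  be what the author meant; OPEN — neither proved nor refuted here).
* §3 **WHY C′ RESISTS THE CHEAP ATTACKS** (recorded so the re-armed disprover does not redo them):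
  (a) *satisfiability of `AdmR`*: clauses 1–6, 8, 9 hold for `k`-subdivided `{4,5}` covers with girth `≫ k` by inspection
  (graph distance in the CAT(0) development = number of separating walls, so big-square centres are at distance exactly `k`
  from the four corner cones: density `≤ k` with equality, deep points exist since `3⌊k/4⌋ < k`; charts of sup-radius
  `⌊k/4⌋` at points farther than `⌊k/2⌋` from all cones develop injectively and meet no cone; verified on the cone patch for
  `k = 8…20` by refuter-rattack `repair_check.py`); clause 7 (Poincaré `10⁶k²`) is the printed expander input
  (Magee–Naud–Puder arXiv:2003.10911 Thm 1.1, `3/16 − ε`; discretisation constant `≈ k²/(s²λ₁) ≈ 4k²`, `s ≈ 1.25` the side of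
  the `2π/5`-angled square) — so no second combinatorial unsatisfiability was found; the ∃ lets the PROVER pick large-girth
  expander covers, and nothing in `AdmR` forces girth → ∞ (a hazard only for the ∀-family siblings 15825/15827, cf. the
  15825 strategist's R-c).  (b) *junk / vacuity audit of the anchor conjunct* (re-done; agrees with ATTACK-15826): `X` is a
  genuine product-Haar Wilson–Gibbs ratio (denominator `> 0`), `YMSpecies` are bounded so `|cov| ≤ 2‖A‖‖B‖`, but clause 8
  forces flat pairs at distance `≥ j → ∞` while `C = C(k, β, A, B)` is fixed before `j`, so the bound is contentful; `c / k`
  with `k ≥ 8` has no division junk; the edge×edge plaquette word closes; `Sp A (k/8)` keeps chart reads inside the box with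
  margin `⌊k/4⌋ − ⌊k/8⌋ ≥ 1`.  (c) *quantifier traps*: none — the only `k`-uniform datum is `c`; `β₀` may depend on `k` and
  `C, j₀` on `(k, β, A, B)`, so no order-of-limits witness (β → ∞ before j → ∞, torons) is available to a refuter: at fixed
  `(k, β)` the claim is a finite-correlation-length statement on an expander complex.  (d) *test groups*: `U(1)` / finite /
  disconnected groups are excluded by `IsCompactSimpleLieGroup` (and `U(1)` would SATISFY the anchor: expansion gives the
  photon a mass `≍ 1/k`); no known counterexample family.  (e) *print*: `lit search` (local + arXiv/zbMATH/Crossref,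
  2026-08-17; OpenAlex/S2 429) for hyperbolic-lattice / expander gauge theory finds only 2-d YM on hyperbolic lattices
  (arXiv:2309.03857) — no negative result on weak-coupling clustering on expander complexes.  (f) *the registered line*
  `Lines/giant_beta_gjs.lean`: `stub_towers` is false as typed for the same R3 reason (re-registers verbatim under C′);
  `stub_kunneth` is TRUE as typed (checked by hand here: with `SqCx` one has `d₁ ∘ d₀ = 0`, the `KunnethGap` forms are the
  Künneth Hodge Laplacian `Δ₁^S ⊗ 1 + 1 ⊗ Δ₀^S` on `C¹⊗C⁰` (Koszul sign in `dC`), cross terms cancel, and its least non-zero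
  eigenvalue is `min(λ₁(Δ₀^S), λ₁(Δ₂^S)) ≥ 10⁻⁶/k²` from `Poinc` and `Coh` + clause 3 + `DualPoinc`); `stub_gjs` is
  vacuously true as typed (its admissibility hypothesis is unsatisfiable) and becomes the open analytic heart under C′ —
  its named risks (non-abelian block-axial gauge on depth-`k` trees, the light fibred sector `harmonic ⊗ functions`, bad
  regions across cone lines) are analysis, not refutable by small models.
* §4 **NEXT FOR A RE-ARMED DISPROVER** (once C′ is filed): target `stub_gjs`'s toron claim at FIXED `(k, β)` — does the
  covariance of two chart-read plaquettes on `S_(k,j) × S_(k,j)` acquire a `j`-dependent floor from the `4g_j` flat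
  directions (genus per unit volume is constant, `g_j = 3n_j + 1` for degree-`n_j` covers of Bring's `{4,5}` map)?  A
  `kit` toy (SU(2) heat bath, `k = 8`, two cover degrees) can see a floor; a floor uniform in the separation would refute C′
  substantively.

## Targets

None this cycle (payload `targets` / `stuck_stubs` empty; no `PICKED.md` for this crux).
-/

set_option autoImplicit false

namespace Summit.QuantumFields.YangMills.Cruxes.CurvatureAnchor.Disproof

open Summit.QuantumFields.YangMills.Cruxes.HyperbolicToTorus.NoAdmissibleComplex

/-! ## §0 The crux as typed is false -/

/-- **Index entry — the kill.** `CurvatureAnchor` is false as typed; landed refutation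
`Summit.QuantumFields.YangMills.Theorems.not_CurvatureAnchor` (refuted-misstated; witness `SU(2)` + `no_admissible` at
`(400, 0)`). -/
theorem curvatureAnchor_false : ¬ Summit.QuantumFields.YangMills.Theses.HyperbolicRegulator.CurvatureAnchor :=
  Summit.QuantumFields.YangMills.Theorems.not_CurvatureAnchor

/-- **The `G`-free core of the kill.** No family of finite square complexes is admissible (the crux's `(Fam k j …).1`,
named `NoAdmissibleComplex.Adm`) at every curvature scale `k ≥ 8`: admissibility already fails at the single scale
`k = 208`, `j = 0`, whatever the data.  The anchor conjunct, the group and the representation play no role. -/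
theorem no_admissible_family
    (V E Q : ℕ → ℕ → Finset ℕ) (σ τ : ℕ → ℕ → ℕ → ℕ) (bd : ℕ → ℕ → ℕ → Fin 4 → ℕ × Bool)
    (cV : ℕ → ℕ → ℕ → ℤ × ℤ → ℕ) (cE : ℕ → ℕ → ℕ → ℤ × ℤ → Fin 2 → ℕ × Bool) :
    ¬ ∀ k j : ℕ, 8 ≤ k → Adm k j (V k j) (E k j) (Q k j) (σ k j) (τ k j) (bd k j) (cV k j) (cE k j) :=
  fun h => no_admissible 208 0 _ _ _ _ _ _ _ _ le_rfl (h 208 0 (by norm_num))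

/-! ## §1 Load-bearing analysis of the kill -/

/-- **Where the landed constants bite.** `no_admissible` closes `k / 4 ≤ sphereCard + 1` against `sphereCard ≤ 50`, i.e.
exactly when `50 < k / 4 - 1`, i.e. `208 ≤ k`.  Capping `k` below `208` in a restate would dodge the THEOREM, not the
defect (the intended complexes violate clause 9 from `k = 12` on). -/
theorem clash_threshold (k : ℕ) : 50 < k / 4 - 1 ↔ 208 ≤ k := by
  omega

/-! ## §2 The repair C′ -/

/-- **`AdmR` — the R3-REPAIRED admissibility predicate** (C′'s `(Fam k j …).1`): VERBATIM `NoAdmissibleComplex.Adm` with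
exactly two tokens changed — flat threshold `k / 2 < Γ.dist x c` (was `k / 4`) and deep threshold
`3 * (k / 4) < Γ.dist x c` (was `k / 2`); the chart box `ib` stays at `(k : ℤ) / 4`. -/
def AdmR (k j : ℕ) (V E Q : Finset ℕ) (σ τ : ℕ → ℕ) (bd : ℕ → Fin 4 → ℕ × Bool) (cV : ℕ → ℤ × ℤ → ℕ)
    (cE : ℕ → ℤ × ℤ → Fin 2 → ℕ × Bool) : Prop :=
  let st := fun e : ℕ × Bool => if e.2 then σ e.1 else τ e.1; let en := fun e : ℕ × Bool => if e.2 then τ e.1 else σ e.1; let Γ := SimpleGraph.fromRel fun a b : ℕ => ∃ e ∈ E, σ e = a ∧ τ e = b; let dg := fun x : ℕ => (E.filter fun e => σ e = x ∨ τ e = x).card; let K := V.filter fun x => dg x = 5; let F := fun x : ℕ => x ∈ V ∧ ∀ c ∈ K, k / 2 < Γ.dist x c; let Dp := fun x : ℕ => x ∈ V ∧ ∀ c ∈ K, 3 * (k / 4) < Γ.dist x c; let ib := fun a : ℤ × ℤ => |a.1| ≤ (k : ℤ) / 4 ∧ |a.2| ≤ (k : ℤ) / 4; let nx := fun (a : ℤ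 × ℤ) (μ : Fin 2) => if μ = 0 then (a.1 + 1, a.2) else (a.1, a.2 + 1); (∀ e ∈ E, σ e ∈ V ∧ τ e ∈ V ∧ σ e ≠ τ e) ∧ (∀ q ∈ Q, (∀ i, (bd q i).1 ∈ E) ∧ (∀ i, en (bd q i) = st (bd q (i + 1))) ∧ (st ∘ bd q).Injective) ∧ (∀ e ∈ E, (Q.filter fun q => ∃ i, (bd q i).1 = e).card = 2) ∧ (∀ x ∈ V, (dg x = 4 ∨ dg x = 5) ∧ (Q.filter fun q => ∃ i, st (bd q i) = x).card = dg x) ∧ (∀ x ∈ V, ∃ c ∈ K, Γ.dist x c ≤ k) ∧ (∀ c ∈ K, ∀ c' ∈ K, c ≠ c' → k ≤ Γ.dist c c') ∧ (∀ f : ℕ → ℝ, ∑ x ∈ V, f x = 0 → ∑ x ∈ V, f x ^ 2 ≤ 10 ^ 6 * (k : ℝ) ^ 2 * ∑ e ∈ E, (f (σ e) - f (τ e)) ^ 2) ∧ (∃ x y, Dp x ∧ Dp y ∧ j ≤ Γ.dist x y) ∧ (∀ x, F x → cV x (0, 0) = x ∧ (∀ a, ib a → cV x a ∈ V) ∧ Set.InjOn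 (cV x) {a | ib a} ∧ (∀ a μ, ib a → ib (nx a μ) → (cE x a μ).1 ∈ E ∧ st (cE x a μ) = cV x a ∧ en (cE x a μ) = cV x (nx a μ)) ∧ (∀ a, ib a → ib (a.1 + 1, a.2 + 1) → ∃ q ∈ Q, Finset.univ.image (Prod.fst ∘ bd q) = {(cE x a 0).1, (cE x (nx a 0) 1).1, (cE x (nx a 1) 0).1, (cE x a 1).1}))

/-- **Arithmetic of the repair** (ℕ-division, every residue of `k`, `8 ≤ k`): chart reach `2⌊k/4⌋ ≤ ⌊k/2⌋` (so a chart
centred at a C′-flat vertex reaches no cone — `AdmR.chart_avoids_cones`); `⌊k/2⌋ ≤ 3⌊k/4⌋` (C′-deep ⇒ C′-flat);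
`3⌊k/4⌋ < k` (C′-deep points are compatible with `k`-density, clause 5); `1 ≤ ⌊k/8⌋` and `2⌊k/8⌋ ≤ ⌊k/4⌋` (observables of
support radius `⌊k/8⌋` are read strictly inside the chart box). -/
theorem repair_arith (k : ℕ) (hk : 8 ≤ k) :
    2 * (k / 4) ≤ k / 2 ∧ k / 2 ≤ 3 * (k / 4) ∧ 3 * (k / 4) < k ∧ 1 ≤ k / 8 ∧ 2 * (k / 8) ≤ k / 4 := by
  omega

section ChartAvoidsCones

variable {k j : ℕ} {V E Q : Finset ℕ} {σ τ : ℕ → ℕ} {bd : ℕ → Fin 4 → ℕ × Bool} {cV : ℕ → ℤ × ℤ → ℕ}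
  {cE : ℕ → ℤ × ℤ → Fin 2 → ℕ × Bool}

/-- The chart clause of `AdmR` at a C′-flat vertex `x` (definitional unfolding of clause 9). -/
theorem AdmR.chart (hA : AdmR k j V E Q σ τ bd cV cE) {x : ℕ}
    (hx : x ∈ V ∧ ∀ c ∈ conesOf V E σ τ, k / 2 < (graphOf E σ τ).dist x c) :
    cV x (0, 0) = x ∧ (∀ a : ℤ × ℤ, InBox ((k : ℤ) / 4) a → cV x a ∈ V) ∧
      Set.InjOn (cV x) {a | InBox ((k : ℤ) / 4) a} ∧
      (∀ (a : ℤ × ℤ) (μ : Fin 2), InBox ((k : ℤ) / 4) a →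
        InBox ((k : ℤ) / 4) (if μ = 0 then (a.1 + 1, a.2) else (a.1, a.2 + 1)) →
          (cE x a μ).1 ∈ E ∧
          (if (cE x a μ).2 then σ (cE x a μ).1 else τ (cE x a μ).1) = cV x a ∧
          (if (cE x a μ).2 then τ (cE x a μ).1 else σ (cE x a μ).1) =
            cV x (if μ = 0 then (a.1 + 1, a.2) else (a.1, a.2 + 1))) := by
  obtain ⟨-, -, -, -, -, -, -, -, h9⟩ := hA
  obtain ⟨h0, hmem, hinj, hedge, -⟩ := h9 x hx
  exact ⟨h0, hmem, hinj, hedge⟩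

/-- One chart step is a `Γ`-edge: `cV x a ~ cV x (a + e_μ)` whenever both points are in the box (clause 9d gives the
edge, injectivity 9c makes its endpoints distinct). -/
theorem AdmR.chart_adj (hA : AdmR k j V E Q σ τ bd cV cE) {x : ℕ}
    (hx : x ∈ V ∧ ∀ c ∈ conesOf V E σ τ, k / 2 < (graphOf E σ τ).dist x c)
    (a : ℤ × ℤ) (μ : Fin 2) (ha : InBox ((k : ℤ) / 4) a)
    (hb : InBox ((k : ℤ) / 4) (if μ = 0 then (a.1 + 1, a.2) else (a.1, a.2 + 1))) :
    (graphOf E σ τ).Adj (cV x a) (cV x (if μ = 0 then (a.1 + 1, a.2) else (a.1, a.2 + 1))) := by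
  obtain ⟨-, -, hinj, hedge⟩ := hA.chart hx
  obtain ⟨hE, hst, hen⟩ := hedge a μ ha hb
  have hne : cV x a ≠ cV x (if μ = 0 then (a.1 + 1, a.2) else (a.1, a.2 + 1)) := by
    intro h
    have := hinj ha hb h
    fin_cases μ <;> simp [Prod.ext_iff] at this
  rw [graphOf, SimpleGraph.fromRel_adj]
  refine ⟨hne, ?_⟩
  by_cases h2 : (cE x a μ).2 = true
  · left
    simp only [h2, if_true] at hst hen
    exact ⟨(cE x a μ).1, hE, hst, hen⟩
  · right
    simp only [h2] at hst hen
    exact ⟨(cE x a μ).1, hE, hen, hst⟩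

/-- Box bookkeeping (pure arithmetic): every non-zero box point has a box neighbour one step closer to the origin in
`ℓ¹`, related to it by a unit chart step in one of the two orders. -/
theorem exists_pred {R : ℤ} {a : ℤ × ℤ} (ha : InBox R a) (h0 : a ≠ (0, 0)) :
    ∃ a' : ℤ × ℤ, InBox R a' ∧ |a'.1| + |a'.2| + 1 = |a.1| + |a.2| ∧
      ∃ μ : Fin 2, a = (if μ = 0 then (a'.1 + 1, a'.2) else (a'.1, a'.2 + 1)) ∨
        a' = (if μ = 0 then (a.1 + 1, a.2) else (a.1, a.2 + 1)) := by
  obtain ⟨x, y⟩ := a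
  obtain ⟨h1, h2⟩ := ha
  change |x| ≤ R at h1
  change |y| ≤ R at h2
  rw [abs_le] at h1 h2
  rcases lt_trichotomy x 0 with hx | rfl | hx
  · refine ⟨(x + 1, y), ⟨?_, ?_⟩, ?_, 0, Or.inr ?_⟩
    · show |x + 1| ≤ R
      rw [abs_le]; omega
    · show |y| ≤ R
      rw [abs_le]; omega
    · show |x + 1| + |y| + 1 = |x| + |y|
      rw [abs_of_neg hx, abs_of_nonpos (by omega : x + 1 ≤ 0)]; ring
    · rw [if_pos rfl]
  · rcases lt_trichotomy y 0 with hy | rfl | hy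
    · refine ⟨(0, y + 1), ⟨?_, ?_⟩, ?_, 1, Or.inr ?_⟩
      · show |(0 : ℤ)| ≤ R
        rw [abs_le]; omega
      · show |y + 1| ≤ R
        rw [abs_le]; omega
      · show |(0 : ℤ)| + |y + 1| + 1 = |(0 : ℤ)| + |y|
        rw [abs_of_neg hy, abs_of_nonpos (by omega : y + 1 ≤ 0)]; ring
      · rw [if_neg (by decide)]
    · exact absurd rfl h0
    · refine ⟨(0, y - 1), ⟨?_, ?_⟩, ?_, 1, Or.inl ?_⟩
      · show |(0 : ℤ)| ≤ R
        rw [abs_le]; omega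
      · show |y - 1| ≤ R
        rw [abs_le]; omega
      · show |(0 : ℤ)| + |y - 1| + 1 = |(0 : ℤ)| + |y|
        rw [abs_of_pos hy, abs_of_nonneg (by omega : (0 : ℤ) ≤ y - 1)]; ring
      · rw [if_neg (by decide)]
        simp
  · refine ⟨(x - 1, y), ⟨?_, ?_⟩, ?_, 0, Or.inl ?_⟩
    · show |x - 1| ≤ R
      rw [abs_le]; omega
    · show |y| ≤ R
      rw [abs_le]; omega
    · show |x - 1| + |y| + 1 = |x| + |y|
      rw [abs_of_pos hx, abs_of_nonneg (by omega : (0 : ℤ) ≤ x - 1)]; ring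
    · rw [if_pos rfl]
      simp

/-- Chart points are reached from the centre by a walk along chart edges of length `≤ |a.1| + |a.2|`. -/
theorem AdmR.chart_walk (hA : AdmR k j V E Q σ τ bd cV cE) {x : ℕ}
    (hx : x ∈ V ∧ ∀ c ∈ conesOf V E σ τ, k / 2 < (graphOf E σ τ).dist x c) :
    ∀ (n : ℕ) (a : ℤ × ℤ), InBox ((k : ℤ) / 4) a → |a.1| + |a.2| ≤ n →
      ∃ p : (graphOf E σ τ).Walk x (cV x a), p.length ≤ n := by
  intro n
  induction n with
  | zero =>
    intro a ha hn
    have ha1 := abs_nonneg a.1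
    have ha2 := abs_nonneg a.2
    have h1 : a.1 = 0 := abs_eq_zero.mp (by push_cast at hn; omega)
    have h2 : a.2 = 0 := abs_eq_zero.mp (by push_cast at hn; omega)
    obtain ⟨a1, a2⟩ := a
    change a1 = 0 at h1
    change a2 = 0 at h2
    subst h1
    subst h2
    exact ⟨SimpleGraph.Walk.nil.copy rfl (hA.chart hx).1.symm, by simp⟩
  | succ n ih =>
    intro a ha hn
    by_cases h0 : a = (0, 0)
    · subst h0
      exact ⟨SimpleGraph.Walk.nil.copy rfl (hA.chart hx).1.symm, by simp⟩
    obtain ⟨a', ha', hnorm, μ, hstep⟩ := exists_pred ha h0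
    obtain ⟨p, hp⟩ := ih a' ha' (by push_cast at hn ⊢; omega)
    have hadj : (graphOf E σ τ).Adj (cV x a') (cV x a) := by
      rcases hstep with h | h
      · have h' := hA.chart_adj hx a' μ ha' (by rw [← h]; exact ha)
        rw [← h] at h'
        exact h'
      · have h' := hA.chart_adj hx a μ ha (by rw [← h]; exact ha')
        rw [← h] at h'
        exact h'.symm
    exact ⟨p.concat hadj, by rw [SimpleGraph.Walk.length_concat]; omega⟩

/-- Hence chart points are within graph distance `|a.1| + |a.2|` of the centre. -/
theorem AdmR.chart_dist_le (hA : AdmR k j V E Q σ τ bd cV cE) {x : ℕ}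
    (hx : x ∈ V ∧ ∀ c ∈ conesOf V E σ τ, k / 2 < (graphOf E σ τ).dist x c)
    (n : ℕ) (a : ℤ × ℤ) (ha : InBox ((k : ℤ) / 4) a) (hn : |a.1| + |a.2| ≤ n) :
    (graphOf E σ τ).dist x (cV x a) ≤ n := by
  obtain ⟨p, hp⟩ := hA.chart_walk hx n a ha hn
  exact (SimpleGraph.dist_le p).trans hp

/-- **Under the repaired admissibility `AdmR`, no chart contains a cone** (every `k`, every complex — not only the
intended one): a chart point is within `2⌊k/4⌋ ≤ ⌊k/2⌋` of its C′-flat centre, which is farther than `⌊k/2⌋` from every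
cone.  This closes the entry point of `NoAdmissibleComplex.no_admissible` (a cone on the rim / axis of the chart of a
first-flat-shell vertex): the refutation of the crux as typed does NOT transfer to C′ by this mechanism. -/
theorem AdmR.chart_avoids_cones (hA : AdmR k j V E Q σ τ bd cV cE) {x : ℕ}
    (hx : x ∈ V ∧ ∀ c ∈ conesOf V E σ τ, k / 2 < (graphOf E σ τ).dist x c)
    {a : ℤ × ℤ} (ha : InBox ((k : ℤ) / 4) a) : cV x a ∉ conesOf V E σ τ := by
  intro hc
  have h1 : (graphOf E σ τ).dist x (cV x a) ≤ 2 * (k / 4) :=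
    hA.chart_dist_le hx (2 * (k / 4)) a ha (by obtain ⟨h1, h2⟩ := ha; push_cast; omega)
  have h2 := hx.2 _ hc
  omega

end ChartAvoidsCones

/-- **C′ = `CurvatureAnchorR`, the repaired crux** (what the author plainly meant; the minimal repair R-a of the refuters,
to be applied in LOCKSTEP to the three `Fam` cruxes): the route decl `CurvatureAnchor` with exactly the two threshold
tokens of `AdmR` changed and NOTHING else.  STATUS: OPEN — neither proved nor refuted in this file; §3 of the module
docstring records why the cheap attacks fail.  (Typed here so that the planner's restate and the re-armed disprover have
a byte-exact target; it elaborates with the route file's imports.) -/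
def CurvatureAnchorR : Prop :=
  open Literature.MathematicalPhysics.QuantumFieldTheory Literature.MathematicalPhysics.QuantumLattice MeasureTheory in ∀ (G : Type) [Group G] [TopologicalSpace G] [IsTopologicalGroup G] [CompactSpace G], IsCompactSimpleLieGroup G → letI : MeasurableSpace G := borel G; haveI : BorelSpace G := ⟨rfl⟩; ∀ r : LatticeRep G, let Fam := fun (k j : ℕ) (V E Q : Finset ℕ) (σ τ : ℕ → ℕ) (bd : ℕ → Fin 4 → ℕ × Bool) (cV : ℕ → ℤ × ℤ → ℕ) (cE : ℕ → ℤ × ℤ → Fin 2 → ℕ × Bool) => let st := fun e : ℕ × Bool => if e.2 then σ e.1 else τ e.1; let en := fun e : ℕ × Bool => if e.2 then τ e.1 else σ e.1; let Γ := SimpleGraph.fromRel fun a b : ℕ => ∃ e ∈ E, σ e = a ∧ τ e = b; let dg := fun x : ℕ => (E.filter fun e => σ e = x ∨ τ e = x).card; let K := V.filter fun x => dg x = 5; let F := fun x : ℕ => x ∈ V ∧ ∀ c ∈ K, k / 2 < Γ.dist x c; let Dp := fun x : ℕ => x ∈ V ∧ ∀ c ∈ K, 3 * (k / 4) < Γ.dist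 x c; let ib := fun a : ℤ × ℤ => |a.1| ≤ (k : ℤ) / 4 ∧ |a.2| ≤ (k : ℤ) / 4; let nx := fun (a : ℤ × ℤ) (μ : Fin 2) => if μ = 0 then (a.1 + 1, a.2) else (a.1, a.2 + 1); let Ed := (ℕ × ℕ) ⊕ (ℕ × ℕ); let PE : Finset Ed := (E ×ˢ V).disjSum (V ×ˢ E); let Cfg := ↥PE → G; let ν := Measure.pi fun _ : ↥PE => haarProbability G; let v := fun (U : Cfg) (e : Ed × Bool) => if h : e.1 ∈ PE then (if e.2 then U ⟨e.1, h⟩ else (U ⟨e.1, h⟩)⁻¹) else 1; let w := fun (U : Cfg) (e : Fin 4 → Ed × Bool) => (r.ρ (v U (e 0) * v U (e 1) * v U (e 2) * v U (e 3))).trace.re; let S := fun U : Cfg => (∑ q ∈ Q, ∑ y ∈ V, w U fun i => (Sum.inl ((bd q i).1, y), (bd q i).2)) + (∑ y ∈ V, ∑ q ∈ Q, w U fun i => (Sum.inr (y, (bd q i).1), (bd q i).2)) + ∑ e ∈ E, ∑ e' ∈ E, w U ![(Sum.inl (e, σ e'), true), (Sum.inr (τ e, e'), true), (Sum.inl (e,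 τ e'), false), (Sum.inr (σ e, e'), false)]; let d0 : Fin 4 → Fin 2 := ![0, 1, 0, 1]; let P := fun (x x' : ℕ) (U : Cfg) (p : ZdEdge 4) => let a := (p.1 0, p.1 1); let b := (p.1 2, p.1 3); if p.2 = 0 ∨ p.2 = 1 then v U (Sum.inl ((cE x a (d0 p.2)).1, cV x' b), (cE x a (d0 p.2)).2) else v U (Sum.inr (cV x a, (cE x' b (d0 p.2)).1), (cE x' b (d0 p.2)).2); ((∀ e ∈ E, σ e ∈ V ∧ τ e ∈ V ∧ σ e ≠ τ e) ∧ (∀ q ∈ Q, (∀ i, (bd q i).1 ∈ E) ∧ (∀ i, en (bd q i) = st (bd q (i + 1))) ∧ (st ∘ bd q).Injective) ∧ (∀ e ∈ E, (Q.filter fun q => ∃ i, (bd q i).1 = e).card = 2) ∧ (∀ x ∈ V, (dg x = 4 ∨ dg x = 5) ∧ (Q.filter fun q => ∃ i, st (bd q i) = x).card = dg x) ∧ (∀ x ∈ V, ∃ c ∈ K, Γ.dist x c ≤ k) ∧ (∀ c ∈ K, ∀ c' ∈ K, c ≠ c' → k ≤ Γ.dist c c') ∧ (∀ f : ℕ →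 ℝ, ∑ x ∈ V, f x = 0 → ∑ x ∈ V, f x ^ 2 ≤ 10 ^ 6 * (k : ℝ) ^ 2 * ∑ e ∈ E, (f (σ e) - f (τ e)) ^ 2) ∧ (∃ x y, Dp x ∧ Dp y ∧ j ≤ Γ.dist x y) ∧ (∀ x, F x → cV x (0, 0) = x ∧ (∀ a, ib a → cV x a ∈ V) ∧ Set.InjOn (cV x) {a | ib a} ∧ (∀ a μ, ib a → ib (nx a μ) → (cE x a μ).1 ∈ E ∧ st (cE x a μ) = cV x a ∧ en (cE x a μ) = cV x (nx a μ)) ∧ (∀ a, ib a → ib (a.1 + 1, a.2 + 1) → ∃ q ∈ Q, Finset.univ.image (Prod.fst ∘ bd q) = {(cE x a 0).1, (cE x (nx a 0) 1).1, (cE x (nx a 1) 0).1, (cE x a 1).1})), fun (β m C : ℝ) (A B : YMSpecies G) => let X := fun f : Cfg → ℝ => (∫ U, f U * Real.exp (β * S U) ∂ν) / (∫ U, Real.exp (β * S U) ∂ν); ∀ x x' y y', F x → F x' → F y → F y' → |X (fun U => A.F (P x x' U) * B.F (P y y' U)) - X (fun U => A.F (P x x' U)) * X (fun U => B.F (P y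 y' U))| ≤ C * Real.exp (-(m * ((Γ.dist x y + Γ.dist x' y' : ℕ) : ℝ)))); let Sp := fun (A : YMSpecies G) (R : ℕ) => ∀ p ∈ A.supp, ∀ i, |p.1 i| ≤ (R : ℤ); ∃ (V E Q : ℕ → ℕ → Finset ℕ) (σ τ : ℕ → ℕ → ℕ → ℕ) (bd : ℕ → ℕ → ℕ → Fin 4 → ℕ × Bool) (cV : ℕ → ℕ → ℕ → ℤ × ℤ → ℕ) (cE : ℕ → ℕ → ℕ → ℤ × ℤ → Fin 2 → ℕ × Bool), let Φ := fun k j => Fam k j (V k j) (E k j) (Q k j) (σ k j) (τ k j) (bd k j) (cV k j) (cE k j); (∀ k j, 8 ≤ k → (Φ k j).1) ∧ (∃ c : ℝ, 0 < c ∧ ∀ k, 8 ≤ k → ∃ β₀ : ℝ, ∀ β, β₀ ≤ β → ∀ A B : YMSpecies G, Sp A (k / 8) → Sp B (k / 8) → ∃ C j₀, ∀ j, j₀ ≤ j → (Φ k j).2 β (c / k) C A B)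

/-- **Sanity / interface**: the first conjunct of C′ IS `AdmR` (the named predicate and the inlined `(Fam …).1` agree
by `ζδ`-unfolding), so every `AdmR` lemma of §2 applies verbatim to the family a proof of C′ must produce — instantiated
at the certified compact simple Lie group `SU(2)`. -/
theorem admR_of_curvatureAnchorR (h : CurvatureAnchorR) :
    ∃ (V E Q : ℕ → ℕ → Finset ℕ) (σ τ : ℕ → ℕ → ℕ → ℕ) (bd : ℕ → ℕ → ℕ → Fin 4 → ℕ × Bool)
      (cV : ℕ → ℕ → ℕ → ℤ × ℤ → ℕ) (cE : ℕ → ℕ → ℕ → ℤ × ℤ → Fin 2 → ℕ × Bool),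
      ∀ k j : ℕ, 8 ≤ k → AdmR k j (V k j) (E k j) (Q k j) (σ k j) (τ k j) (bd k j) (cV k j) (cE k j) := by
  have hG : Literature.MathematicalPhysics.QuantumFieldTheory.IsCompactSimpleLieGroup
      (Matrix.specialUnitaryGroup (Fin 2) ℂ) :=
    Literature.MathematicalPhysics.QuantumFieldTheory.isCompactSimpleLieGroup_specialUnitaryGroup
      Literature.MathematicalPhysics.QuantumLattice.isSimpleCompactGroup_specialUnitaryGroup_holds le_rfl
  obtain ⟨r⟩ := hG.2
  obtain ⟨V, E, Q, σ, τ, bd, cV, cE, hAdm, -⟩ := h (Matrix.specialUnitaryGroup (Fin 2) ℂ) hG r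
  exact ⟨V, E, Q, σ, τ, bd, cV, cE, fun k j hk => hAdm k j hk⟩

end Summit.QuantumFields.YangMills.Cruxes.CurvatureAnchor.Disproof
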